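import Summits.HodgeConjecture.HodgeConjecture.Cruxes.BlochSeedDiscOne.SeedCheckerZeroLocus
import Literature.AlgebraicGeometry.HodgeTheory.BlochSemiregularCompIso
import Literature.AlgebraicGeometry.HodgeTheory.MultiHomMapIso
import Literature.AlgebraicGeometry.Deformation.IdealModulePushforward
import Literature.AlgebraicGeometry.Modules.PushforwardIsoAdjunction
import HarnessLib

/-!
# `Cruxes/BlochSeedDiscOne/SeedCheckerModelTransfer.lean` — SEED CHECKER v29 (§29): C7 MODEL TRANSFER —
# Bloch semiregularity does not see the model of the subscheme, so the lci-door verdict is a function of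
# (design json, presentation, section) ALONE

`line stmt-HodgeConjecture-18881 Cruxes/BlochSeedDiscOne/Lines/birth.lean 814a6a70c14e831a stub_rung_pad4_seedAt` —
unit `hsemireg-c5c8-1` gen 29 (MINT block A5, explicit unit «type C5–C8 as predicates on (design json, presentation) so a
seed checker exists before a candidate does; flag the vacuous ∕ implied ones»). Satellite of v4 `SeedChecker.lean` and v16
`SeedCheckerZeroLocus.lean` (both BUILT on the farm) and of the tree's Literature files
`HodgeTheory/BlochSemiregularCompIso` (AMBIENT-iso invariance of `IsBlochSemiregular`), `HodgeTheory/MultiHomMapIso`,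
`Deformation/IdealModulePushforward`, `Modules/PushforwardIsoAdjunction`.

## §29.0 Honest framing (read first)

NOTHING toward HC ∕ HC_CM ∕ HC_AV ∕ № 4 ∕ 26512 ∕ 18881 ∕ H2 is proved here. No design json, no presentation, no bundle, no
section, no seed is CONSTRUCTED; `stub_rung_pad4_seedAt` and the crux `EightfoldBlochSeeds.BlochSeedDiscOne` stay exactly as
open as before. This file is EVIDENCE + TYPED PLUMBING for the seed checker (not a rung): it closes the one conjunct of the
lci door that v16 could NOT transfer between models of the zero scheme.

## What v16 left open, and what this file does with it

v16 §19.5 proved that C5 (regular immersion of codimension `4`), C6 (integral; closed points of codimension `≥ 4`) and the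
(σ) support clause of v4's `Design.SeedCheck` transfer between any two zero schemes `i : Z ↪ S⁴`, `i' : Z' ↪ S⁴` of the
same section (they are uniquely isomorphic OVER `S⁴`, `IsZeroSchemeOf.exists_iso`), but flagged C7 — `IsBlochSemiregular i 8 4`
— as NOT transferred: the tree's only invariance theorem `IsBlochSemiregular.comp_iso` moves the AMBIENT scheme
(`i ↦ i ≫ e.hom.left` for `e : X₀ ≅ X₁`), not the SOURCE (`i ↦ e.hom ≫ i` for `e : Z' ≅ Z`); so v16's
`Design.SeedCheck.of_isZeroSchemeOf` carries C7 on the new model as a hypothesis `hsr'` (family index g26 §7: «C7 model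
transfer OPEN»). Here (everything PROVED, kernel-checked, no `sorry`, no new axiom):

* §29.1 **THE IDEAL MODULE DOES NOT SEE THE MODEL**: `idealModuleIsoComp e i : 𝓘_{e ≫ i} ≅ 𝓘_i` for an isomorphism
  `e : Z' ≅ Z` and any `i : Z ⟶ Y`, compatible with the inclusions into `𝒪_Y` (`kernel.lift` both ways: `(e ≫ i)♯ = i♯ ≫ i_*(e♯)`
  up to `pushforwardComp`, tree `structureModuleMap_comp`, and `i_*(e♯)` is an isomorphism, tree `isIso_structureModuleMap_hom`).
* §29.2 **`Ωᴺ|_{Z'} ≅ Ωᴺ|_Z` OVER `X`**: `formsOnSubschemeIsoComp e i N : (e ≫ i)_*(e ≫ i)^*Ωᴺ ≅ i_* i^*Ωᴺ` (Mathlib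
  `pullbackComp`, `pushforwardComp`, and the unit `B ⟶ e_* e^* B`, an isomorphism because `e_*` is an equivalence — tree
  `isEquivalence_pushforward_hom`), COMPATIBLE WITH THE RESTRICTION OF FORMS `restrictForms (e ≫ i) N ≫ hom = restrictForms i N`
  (the tree's unit coherence `unitApp_comp`).
* §29.3 **NATURALITY OF BLOCH'S PAIRING UNDER `Z' ≅ Z`**: `blochPairingSheafHom (e ≫ i) r j ≫ μ.hom = blochPairingSheafHom i r j`
  with `μ = multiHomMapIso (idealModuleIsoComp e i) (formsOnSubschemeIsoComp e i _) r` (BF (8.1): the pairing is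
  `ω ↦ (a ↦ (dι a₀ ∧ ⋯ ∧ ω)|_Z)`, and both `ι` and `|_Z` are matched by §29.1–§29.2 — checked on tuples of ideal sections with the
  tree's `multiHom_ext_of_evalMulti`, `evalMulti_multiHomMapIso_hom_app`, `evalMulti_blochPairingSheafHom_app`), and its
  alternating form `blochPairingAltSheafHom (e ≫ i) r j ≫ (altMultiHomMapIso …).hom = blochPairingAltSheafHom i r j`.
* §29.4 **C7 MODEL TRANSFER — THE THEOREM**: `isBlochSemiregular_isoComp_iff : IsBlochSemiregular (e.hom ≫ i) n p ↔
  IsBlochSemiregular i n p` (all `n p`; cohomology of an isomorphism of coefficient modules is bijective, tree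
  `moduleSheafCohomology_map_bijective`), the over-`X` form `isBlochSemiregular_iff_of_iso_over`, and — with the tree's ambient
  invariance made an `iff` (`isBlochSemiregular_compIso_iff`) — invariance under isomorphisms of PAIRS `isBlochSemiregular_iff_of_iso_pair`.
* §29.5 **THE CHECKER CONSEQUENCES**: `isBlochSemiregular_iff_of_isZeroSchemeOf` (C7 agrees on any two zero schemes of the same
  section); `Design.SeedCheck.of_isZeroSchemeOf'` = v16's door WITHOUT `hsr'`; `Design.seedCheck_iff_of_isZeroSchemeOf` and
  `Design.seedCheck_iff_zeroSchemeι`: **`D.SeedCheck K i q ↔ D.SeedCheck K (Z(s(1)) ↪ S⁴) q`** for every zero scheme `i` of `s`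
  (`𝓕` finite locally free) — the lci-door verdict is a FUNCTION OF (design json `D`, presentation `𝓕`, section `s`), the
  carrier having dropped out entirely; `Design.seedCheck_of_section_anyModel`: C5 ∕ C6 ∕ C7 may each be certified on whichever
  model of the zero scheme is convenient.
* §29.6 flags and audit (`audit_nothing_decided`).

Typer lint: no `instance`, no `notation` ∕ `macro`, no `axiom`, no `sorry`, no `allowUnsafeReducibility`; options:
`linter.dupNamespace false` (Cruxes workfile convention v4–v28) and `backward.isDefEq.respectTransparency false` (exactly as
the tree's `HodgeTheory/MultiHomMapIso.lean`, `HodgeTheory/BlochSemiregularCompIso.lean`: `Scheme.Modules` is not reducible).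

## References
* [BuchweitzFlenner2003] R.-O. Buchweitz, H. Flenner, *A semiregularity map for modules and applications to deformations*,
  Compositio Math. 137 (2003), (8.1) (1)–(2) (the pairing `Ω^{m+1}_X × Λ^{q-1}𝒩^∨ → ω_X ⊗ 𝒪_Z` and the induced map in
  cohomology; reading: intrinsic to the closed subscheme, hence invariant under isomorphisms of the source over `X`).
* [Bloch1972Semiregularity] S. Bloch, *Semi-regularity and de Rham cohomology*, Invent. Math. 17 (1972), §1 (cite-only via BF).
* [Fulton1998] W. Fulton, *Intersection Theory*, 2nd ed. (1998), App. B.3.2, B.3.4 (PDF pp. 410–411) (zero schemes of sections).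
* [StacksProject] Tag 08KY (the ideal `𝓘 = Ker(i♯)`), Tag 01CM (internal Hom is a functor in both variables).
* [Hartshorne1977] R. Hartshorne, *Algebraic Geometry* (1977), II §5 p. 110 (`f^* ⊣ f_*`).
-/

noncomputable section

set_option linter.dupNamespace false
-- `TopCat.Presheaf`/`Scheme.Modules` are not reducible (as in Mathlib's `AlgebraicGeometry/Modules/Sheaf.lean` and the tree's
-- `HodgeTheory/MultiHomMapIso.lean`, `HodgeTheory/BlochSemiregularCompIso.lean`).
set_option backward.isDefEq.respectTransparency false

open CategoryTheory CategoryTheory.Limits AlgebraicGeometry TopologicalSpace Opposite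
open Literature.AlgebraicGeometry Literature.AlgebraicGeometry.Motives Literature.AlgebraicGeometry.HodgeTheory
open Literature.AlgebraicGeometry.Modules Literature.AlgebraicGeometry.Deformation

namespace Summit.HodgeConjecture.HodgeConjecture.Cruxes.BlochSeedDiscOne.SeedChecker.ModelTransfer

open Summit.HodgeConjecture.HodgeConjecture.Cruxes.BlochSeedDiscOne.Anchor
open Summit.HodgeConjecture.HodgeConjecture.Cruxes.BlochSeedDiscOne.SeedChecker.ZeroLocus
open Summit.Ventures.HSemireg Summit.Ventures.HSemireg.Pad4Tower

universe u

/-! ## §29.1 The ideal module does not see the model: `𝓘_{e ≫ i} ≅ 𝓘_i` compatibly with `ι` -/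

section Ideal

variable {Z' Z Y : Scheme.{u}} (e : Z' ≅ Z) (i : Z ⟶ Y)

/-- `(e ≫ i)♯ = (i♯ ≫ i_*(e♯)) ≫ ((e ≫ i)_* ≅ i_* e_*).hom` (tree `structureModuleMap_comp`, solved for `(e ≫ i)♯`).
[cite: StacksProject, Tag 08KY (the ideal Ker(i♯); reading: functoriality along an isomorphism of the source)] -/
theorem structureModuleMap_isoComp :
    structureModuleMap (e.hom ≫ i) =
      (structureModuleMap i ≫ (Scheme.Modules.pushforward i).map (structureModuleMap e.hom)) ≫
        ((Scheme.Modules.pushforwardComp e.hom i).app (structureSheafModule Z')).hom := by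
  rw [← structureModuleMap_comp e.hom i, Category.assoc, Iso.inv_hom_id, Category.comp_id]

/-- `ι_{e ≫ i} ≫ i♯ = 0`: a function vanishing on `Z'` vanishes on `Z` (`i_*(e♯)` is an isomorphism).
[cite: StacksProject, Tag 08KY (the ideal Ker(i♯); reading: functoriality along an isomorphism of the source)] -/
theorem idealModuleι_isoComp_comp_structureModuleMap : idealModuleι (e.hom ≫ i) ≫ structureModuleMap i = 0 := by
  have h := idealModuleι_comp_structureModuleMap (e.hom ≫ i)
  rw [structureModuleMap_isoComp e i, ← Category.assoc, ← Category.assoc] at h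
  rw [← cancel_mono ((Scheme.Modules.pushforward i).map (structureModuleMap e.hom)),
    ← cancel_mono ((Scheme.Modules.pushforwardComp e.hom i).app (structureSheafModule Z')).hom, h, zero_comp, zero_comp]

/-- `ι_i ≫ (e ≫ i)♯ = 0`: a function vanishing on `Z` vanishes on `Z'`.
[cite: StacksProject, Tag 08KY (the ideal Ker(i♯); reading: functoriality along an isomorphism of the source)] -/
theorem idealModuleι_comp_structureModuleMap_isoComp : idealModuleι i ≫ structureModuleMap (e.hom ≫ i) = 0 := by
  rw [structureModuleMap_isoComp e i, ← Category.assoc, ← Category.assoc, idealModuleι_comp_structureModuleMap, zero_comp,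
    zero_comp]

/-- `𝓘_{e ≫ i} ⟶ 𝓘_i`. [cite: StacksProject, Tag 08KY (the ideal Ker(i♯); reading: functoriality along an isomorphism of the source)] -/
def idealModuleIsoCompHom : idealModule (e.hom ≫ i) ⟶ idealModule i :=
  kernel.lift (structureModuleMap i) (idealModuleι (e.hom ≫ i)) (idealModuleι_isoComp_comp_structureModuleMap e i)

/-- `𝓘_i ⟶ 𝓘_{e ≫ i}`. [cite: StacksProject, Tag 08KY (the ideal Ker(i♯); reading: functoriality along an isomorphism of the source)] -/
def idealModuleIsoCompInv : idealModule i ⟶ idealModule (e.hom ≫ i) :=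
  kernel.lift (structureModuleMap (e.hom ≫ i)) (idealModuleι i) (idealModuleι_comp_structureModuleMap_isoComp e i)

@[reassoc]
theorem idealModuleIsoCompHom_comp_ι : idealModuleIsoCompHom e i ≫ idealModuleι i = idealModuleι (e.hom ≫ i) :=
  kernel.lift_ι _ _ _

@[reassoc]
theorem idealModuleIsoCompInv_comp_ι : idealModuleIsoCompInv e i ≫ idealModuleι (e.hom ≫ i) = idealModuleι i :=
  kernel.lift_ι _ _ _

/-- **`𝓘_{e ≫ i} ≅ 𝓘_i`**: the ideal module of a subscheme does not depend on the model of the source (both are the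
kernel of "the same" map `𝒪_Y → (·)_*𝒪`, the two targets being identified by the isomorphism `i_*(e♯)`).
[cite: StacksProject, Tag 08KY (the ideal Ker(i♯); reading: functoriality along an isomorphism of the source)] -/
def idealModuleIsoComp : idealModule (e.hom ≫ i) ≅ idealModule i where
  hom := idealModuleIsoCompHom e i
  inv := idealModuleIsoCompInv e i
  hom_inv_id := by
    rw [← cancel_mono (idealModuleι (e.hom ≫ i)), Category.assoc, idealModuleIsoCompInv_comp_ι, idealModuleIsoCompHom_comp_ι,
      Category.id_comp]
  inv_hom_id := by
    rw [← cancel_mono (idealModuleι i), Category.assoc, idealModuleIsoCompHom_comp_ι, idealModuleIsoCompInv_comp_ι,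
      Category.id_comp]

@[reassoc]
theorem idealModuleIsoComp_hom_comp_ι : (idealModuleIsoComp e i).hom ≫ idealModuleι i = idealModuleι (e.hom ≫ i) :=
  idealModuleIsoCompHom_comp_ι e i

@[reassoc]
theorem idealModuleIsoComp_inv_comp_ι : (idealModuleIsoComp e i).inv ≫ idealModuleι (e.hom ≫ i) = idealModuleι i :=
  idealModuleIsoCompInv_comp_ι e i

/-- sectionwise: a section of `𝓘_i` over `W`, moved to `𝓘_{e ≫ i}` by `inv`, has the same image in `𝒪_Y(W)`. [folklore] -/
theorem idealModuleι_app_isoComp_inv_app (W : Y.Opens) (a : Γ(idealModule i, W)) :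
    (idealModuleι (e.hom ≫ i)).app W ((idealModuleIsoComp e i).inv.app W a) = (idealModuleι i).app W a :=
  congrArg (fun φ => Scheme.Modules.Hom.app φ W a) (idealModuleIsoComp_inv_comp_ι e i)

/-- sectionwise, `hom` direction. [folklore] -/
theorem idealModuleι_app_isoComp_hom_app (W : Y.Opens) (a : Γ(idealModule (e.hom ≫ i), W)) :
    (idealModuleι i).app W ((idealModuleIsoComp e i).hom.app W a) = (idealModuleι (e.hom ≫ i)).app W a :=
  congrArg (fun φ => Scheme.Modules.Hom.app φ W a) (idealModuleIsoComp_hom_comp_ι e i)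

end Ideal

/-! ## §29.2 `Ωᴺ|_{Z'} ≅ Ωᴺ|_Z` over `X`, compatibly with the restriction of forms -/

section Forms

variable {S : Type u} [CommRing S] {X : Over (Spec (CommRingCat.of S))} {Z' Z : Scheme.{u}} (e : Z' ≅ Z)
  (i : Z ⟶ X.left)

/-- the unit `B ⟶ e_* e^* B` of `e^* ⊣ e_*` is an isomorphism for an isomorphism `e` (`e_*` is an equivalence, tree
`isEquivalence_pushforward_hom`; Mathlib: the unit of an adjunction whose right adjoint is an equivalence is an isomorphism).
[cite: Hartshorne1977, II §5 p. 110 (f^* is left adjoint to f_*; reading: along an isomorphism both are equivalences)] -/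
theorem isIso_unit_app (B : Z.Modules) : IsIso ((Scheme.Modules.pullbackPushforwardAdjunction e.hom).unit.app B) := by
  infer_instance

/-- `B ≅ e_* e^* B` (nested typing). [folklore] -/
def unitIsoOfIso (B : Z.Modules) :
    B ≅ (Scheme.Modules.pushforward e.hom).obj ((Scheme.Modules.pullback e.hom).obj B) :=
  @asIso _ _ _ _ ((Scheme.Modules.pullbackPushforwardAdjunction e.hom).unit.app B) (isIso_unit_app e B)

/-- **`Ωᴺ|_{Z'} ≅ Ωᴺ|_Z` as `𝒪_X`-modules**: `(e ≫ i)_* (e ≫ i)^* Ωᴺ ≅ (e ≫ i)_* e^* i^* Ωᴺ ≅ i_* e_* e^* (i^* Ωᴺ) ≅ i_* i^* Ωᴺ`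
(Mathlib `pullbackComp`, `pushforwardComp`, and the inverse of the unit isomorphism of §29.2).
[cite: BuchweitzFlenner2003, (8.1) (the sheaf ω_X ⊗ 𝒪_Z; reading: it depends on the closed subscheme only)] -/
def formsOnSubschemeIsoComp (N : ℕ) : formsOnSubscheme (e.hom ≫ i) N ≅ formsOnSubscheme i N :=
  (Scheme.Modules.pushforward (e.hom ≫ i)).mapIso ((Scheme.Modules.pullbackComp e.hom i).symm.app (hodgeSheaf X N)) ≪≫
    (Scheme.Modules.pushforwardComp e.hom i).symm.app _ ≪≫
      (Scheme.Modules.pushforward i).mapIso (unitIsoOfIso e ((Scheme.Modules.pullback i).obj (hodgeSheaf X N))).symm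

/-- **compatibility with the restriction of forms**: `Ωᴺ → Ωᴺ|_{Z'} ≅ Ωᴺ|_Z` is `Ωᴺ → Ωᴺ|_Z` (the tree's unit coherence
`unitApp_comp` — `η_{e≫i} ≫ (e ≫ i)_*((e ≫ i)^* → e^*i^*) = η_i ≫ i_*(η_e) ≫ (i_* e_* → (e ≫ i)_*)` — then cancel
`pushforwardComp` against its inverse and the unit of `e` against its inverse).
[cite: Hartshorne1977, II §5 p. 110 (f^* is left adjoint to f_*; reading: mate calculus along (g ∘ f)_* = g_* ∘ f_*)] -/
theorem restrictForms_comp_formsOnSubschemeIsoComp_hom (N : ℕ) :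
    restrictForms (e.hom ≫ i) N ≫ (formsOnSubschemeIsoComp e i N).hom = restrictForms i N := by
  have hid := (Scheme.Modules.pushforwardComp e.hom i).hom_inv_id_app
    ((Scheme.Modules.pullback e.hom).obj ((Scheme.Modules.pullback i).obj (hodgeSheaf X N)))
  change pushforwardCompHomApp e.hom i _ ≫ pushforwardCompInvApp e.hom i _ = 𝟙 _ at hid
  change (unitApp (e.hom ≫ i) (hodgeSheaf X N) ≫
      (Scheme.Modules.pushforward (e.hom ≫ i)).map (pullbackCompInvApp e.hom i (hodgeSheaf X N))) ≫
        pushforwardCompInvApp e.hom i _ ≫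
          (Scheme.Modules.pushforward i).map (unitIsoOfIso e ((Scheme.Modules.pullback i).obj (hodgeSheaf X N))).inv =
    unitApp i (hodgeSheaf X N)
  rw [unitApp_comp, Category.assoc, Category.assoc,
    ← Category.assoc (pushforwardCompHomApp e.hom i _) (pushforwardCompInvApp e.hom i _), hid, Category.id_comp]
  change unitApp i (hodgeSheaf X N) ≫
      (Scheme.Modules.pushforward i).map (unitIsoOfIso e ((Scheme.Modules.pullback i).obj (hodgeSheaf X N))).hom ≫
        (Scheme.Modules.pushforward i).map (unitIsoOfIso e ((Scheme.Modules.pullback i).obj (hodgeSheaf X N))).inv = _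
  rw [← CategoryTheory.Functor.map_comp, Iso.hom_inv_id, CategoryTheory.Functor.map_id, Category.comp_id]

/-- sectionwise form of the compatibility. [folklore] -/
theorem formsOnSubschemeIsoComp_hom_app_restrictForms_app (N : ℕ) (W : X.left.Opens) (x : Γ(hodgeSheaf X N, W)) :
    (formsOnSubschemeIsoComp e i N).hom.app W ((restrictForms (e.hom ≫ i) N).app W x) = (restrictForms i N).app W x :=
  congrArg (fun φ => Scheme.Modules.Hom.app φ W x) (restrictForms_comp_formsOnSubschemeIsoComp_hom e i N)

end Forms

/-! ## §29.3 Naturality of Bloch's pairing under an isomorphism of the source -/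

section Pairing

variable {S : Type u} [CommRing S] {X : Over (Spec (CommRingCat.of S))} {Z' Z : Scheme.{u}} (e : Z' ≅ Z)
  (i : Z ⟶ X.left) (r j : ℕ)

/-- `d(ι(α⁻¹ a)) = d(ι a)`: the differential of an ideal section does not see the model. [cite: BuchweitzFlenner2003, (8.1) (the map d : J → Ω¹_X)] -/
theorem dIdeal_isoComp_inv_app (W : X.left.Opens) (a : Γ(idealModule i, W)) :
    dIdeal (idealModule (e.hom ≫ i)) (idealModuleι (e.hom ≫ i)) W ((idealModuleIsoComp e i).inv.app W a) =
      dIdeal (idealModule i) (idealModuleι i) W a := by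
  change dSection X W ((idealModuleι (e.hom ≫ i)).app W ((idealModuleIsoComp e i).inv.app W a)) =
    dSection X W ((idealModuleι i).app W a)
  rw [idealModuleι_app_isoComp_inv_app]

/-- **NATURALITY OF BLOCH'S CURRIED PAIRING UNDER `e : Z' ≅ Z` OVER `X`**:
`pairing_{e ≫ i} ≫ multiHomMapIso (𝓘_{e≫i} ≅ 𝓘_i) (Ωᴺ|_{Z'} ≅ Ωᴺ|_Z) = pairing_i` — on a local wedge form `ω` and a tuple `a` of
sections of `𝓘_i` both sides are `(dι a₀ ∧ ⋯ ∧ dι a_{r-1} ∧ ω)|_Z`.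
[cite: BuchweitzFlenner2003, (8.1) (the pairing Ω^{m+1}_X × Λ^{q-1}N^∨ → ω_X ⊗ O_Z; reading: intrinsic to the closed subscheme)] -/
theorem blochPairingSheafHom_comp_multiHomMapIso_hom :
    blochPairingSheafHom (e.hom ≫ i) r j ≫
        (multiHomMapIso (idealModuleIsoComp e i) (formsOnSubschemeIsoComp e i (pairingDegree r j)) r).hom =
      blochPairingSheafHom i r j := by
  apply hodgeSheaf.hom_ext_toHodgeSheaf
  intro U ω
  simp only [Scheme.Modules.Hom.comp_app, CategoryTheory.comp_apply]
  refine multiHom_ext_of_evalMulti _ _ r _ _ fun W k a => ?_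
  rw [evalMulti_multiHomMapIso_hom_app, evalMulti_blochPairingSheafHom_app, evalMulti_blochPairingSheafHom_app]
  have hd : (fun s => dIdeal (idealModule (e.hom ≫ i)) (idealModuleι (e.hom ≫ i)) W
      ((idealModuleIsoComp e i).inv.app W (a s))) = fun s => dIdeal (idealModule i) (idealModuleι i) W (a s) :=
    funext fun s => dIdeal_isoComp_inv_app e i W (a s)
  rw [hd]
  exact formsOnSubschemeIsoComp_hom_app_restrictForms_app e i (pairingDegree r j) W _

/-- **… and for the pairing with alternating values**:
`altPairing_{e ≫ i} ≫ altMultiHomMapIso (𝓘_{e≫i} ≅ 𝓘_i) (Ωᴺ|_{Z'} ≅ Ωᴺ|_Z) = altPairing_i` (after the sectionwise injective `altι`).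
[cite: BuchweitzFlenner2003, (8.1) (1) (the pairing with values in Λ^{q-1}N ⊗ ω_X; reading: intrinsic to the closed subscheme)] -/
theorem blochPairingAltSheafHom_comp_altMultiHomMapIso_hom :
    blochPairingAltSheafHom (e.hom ≫ i) r j ≫
        (altMultiHomMapIso (idealModuleIsoComp e i) (formsOnSubschemeIsoComp e i (pairingDegree r j)) r).hom =
      blochPairingAltSheafHom i r j := by
  have hmono : ∀ {F : X.left.Modules}
      (f g : F ⟶ altMultiHom (idealModule i) (formsOnSubscheme i (pairingDegree r j)) r),
      f ≫ altι _ _ r = g ≫ altι _ _ r → f = g := by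
    intro F f g hfg
    refine Scheme.Modules.hom_ext _ _ fun U => ?_
    ext x
    have hx := congrArg (fun φ => Scheme.Modules.Hom.app φ U x) hfg
    simp only [Scheme.Modules.Hom.comp_app, CategoryTheory.comp_apply] at hx
    exact altι_app_injective (idealModule i) (formsOnSubscheme i (pairingDegree r j)) r U hx
  apply hmono
  rw [Category.assoc]
  change blochPairingAltSheafHom (e.hom ≫ i) r j ≫
      altMultiHomMapHom (idealModuleIsoComp e i) (formsOnSubschemeIsoComp e i (pairingDegree r j)) r ≫ altι _ _ r = _
  rw [altMultiHomMapHom_comp_altι, ← Category.assoc, blochPairingAltSheafHom_comp_altι,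
    blochPairingSheafHom_comp_multiHomMapIso_hom, blochPairingAltSheafHom_comp_altι]

end Pairing

/-! ## §29.4 C7 model transfer: Bloch semiregularity is invariant under isomorphisms of the source over `X` -/

section Transfer

variable {S : Type u} [CommRing S] {X : Over (Spec (CommRingCat.of S))} {Z' Z : Scheme.{u}} (e : Z' ≅ Z)
  (i : Z ⟶ X.left)

/-- `H^k` of a composite of module maps is the composite (Mathlib's `Sheaf.H.map_comp_apply` through `toSheaf`; local copy of
the tree's private lemma of `BlochSemiregularCompIso`). [folklore] -/
theorem moduleSheafCohomology_map_comp_apply {Y : Scheme.{u}} {L L' L'' : Y.Modules} (f : L ⟶ L') (g : L' ⟶ L'') (k : ℕ)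
    (x : moduleSheafCohomology L k) :
    moduleSheafCohomology.map (f ≫ g) k x = moduleSheafCohomology.map g k (moduleSheafCohomology.map f k x) := by
  change Sheaf.H.map ((SheafOfModules.toSheaf Y.ringCatSheaf).map (f ≫ g)) k x = _
  rw [CategoryTheory.Functor.map_comp, Sheaf.H.map_comp_apply]

/-- **the square on cohomology**: `H^k(μ) ∘ blochPairingMap (e ≫ i) = blochPairingMap i`.
[cite: BuchweitzFlenner2003, (8.1) (2) (the induced map in cohomology; reading: intrinsic to the closed subscheme)] -/
theorem map_blochPairingMap_isoComp (r j k : ℕ) (x : hodgeCohomology X j k) :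
    moduleSheafCohomology.map
        (altMultiHomMapIso (idealModuleIsoComp e i) (formsOnSubschemeIsoComp e i (pairingDegree r j)) r).hom k
        (blochPairingMap (e.hom ≫ i) r j k x) =
      blochPairingMap i r j k x := by
  change moduleSheafCohomology.map _ k (moduleSheafCohomology.map (blochPairingAltSheafHom (e.hom ≫ i) r j) k x) =
    moduleSheafCohomology.map (blochPairingAltSheafHom i r j) k x
  rw [← moduleSheafCohomology_map_comp_apply, blochPairingAltSheafHom_comp_altMultiHomMapIso_hom]

/-- **surjectivity of Bloch's pairing in cohomology does not see the model.**
[cite: BuchweitzFlenner2003, (8.1) (2) (the induced map in cohomology; reading: intrinsic to the closed subscheme)] -/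
theorem surjective_blochPairingMap_isoComp_iff (r j k : ℕ) :
    Function.Surjective (blochPairingMap (e.hom ≫ i) r j k) ↔ Function.Surjective (blochPairingMap i r j k) := by
  have hbij := moduleSheafCohomology_map_bijective
    (altMultiHomMapIso (idealModuleIsoComp e i) (formsOnSubschemeIsoComp e i (pairingDegree r j)) r).hom k
  have hcomp : (blochPairingMap i r j k : hodgeCohomology X j k → _) =
      moduleSheafCohomology.map
          (altMultiHomMapIso (idealModuleIsoComp e i) (formsOnSubschemeIsoComp e i (pairingDegree r j)) r).hom k ∘
        blochPairingMap (e.hom ≫ i) r j k :=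
    funext fun x => (map_blochPairingMap_isoComp e i r j k x).symm
  rw [hcomp]
  exact ⟨fun h => hbij.2.comp h, fun h => Function.Surjective.of_comp_left h hbij.1⟩

/-- **C7 MODEL TRANSFER (Bloch semiregularity is invariant under isomorphisms `Z' ≅ Z` of the SOURCE over `X`)**: for every
ambient dimension `n` and codimension `p`, `Z' —(e ≫ i)→ X` is Bloch-semiregular iff `Z —i→ X` is. Companion of the tree's
AMBIENT-iso invariance `IsBlochSemiregular.comp_iso`. [cite: Bloch1972Semiregularity, §1 (the semi-regularity map π of the
pair Z ⊂ X; reading: intrinsic to the closed subscheme, hence invariant under re-modelling Z)] -/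
theorem isBlochSemiregular_isoComp_iff {n p : ℕ} : IsBlochSemiregular (e.hom ≫ i) n p ↔ IsBlochSemiregular i n p :=
  ⟨fun h r m k hp hn hk => (surjective_blochPairingMap_isoComp_iff e i r (m + 1) k).mp (h r m k hp hn hk),
    fun h r m k hp hn hk => (surjective_blochPairingMap_isoComp_iff e i r (m + 1) k).mpr (h r m k hp hn hk)⟩

/-- **… over-`X` form**: two models `i : Z ⟶ X`, `i' : Z' ⟶ X` of a subscheme that are isomorphic OVER `X` have the same C7.
[cite: Bloch1972Semiregularity, §1 (reading: intrinsic to the closed subscheme)] -/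
theorem isBlochSemiregular_iff_of_iso_over {i : Z ⟶ X.left} {i' : Z' ⟶ X.left} (e : Z' ≅ Z) (w : e.hom ≫ i = i')
    {n p : ℕ} : IsBlochSemiregular i' n p ↔ IsBlochSemiregular i n p := by
  subst w
  exact isBlochSemiregular_isoComp_iff e i

/-- the tree's AMBIENT invariance `IsBlochSemiregular.comp_iso` as an `iff` (apply it to `ε` and to `ε.symm`).
[cite: Bloch1972Semiregularity, §1 (reading: intrinsic to the pair Z ⊂ X)] -/
theorem isBlochSemiregular_compIso_iff {X₀ X₁ : Over (Spec (CommRingCat.of S))} (ε : X₀ ≅ X₁) {Z₀ : Scheme.{u}}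
    (i₀ : Z₀ ⟶ X₀.left) {n p : ℕ} : IsBlochSemiregular (i₀ ≫ ε.hom.left) n p ↔ IsBlochSemiregular i₀ n p := by
  refine ⟨fun h => ?_, fun h => h.comp_iso ε⟩
  have h' := h.comp_iso ε.symm
  have hε : ε.hom.left ≫ ε.symm.hom.left = 𝟙 X₀.left := by
    rw [Iso.symm_hom, ← Over.comp_left, Iso.hom_inv_id, Over.id_left]
  rwa [Category.assoc, hε, Category.comp_id] at h'

/-- **C7 IS AN INVARIANT OF THE PAIR `(X ⊃ Z)` UP TO ISOMORPHISM OVER `S`**: for isomorphisms `ε : X₀ ≅ X₁` of `S`-schemes and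
`e : Z₀ ≅ Z₁` of sources with `i₀ ≫ ε = e ≫ i₁`, `IsBlochSemiregular i₀ n p ↔ IsBlochSemiregular i₁ n p` (ambient invariance, tree;
source invariance, §29.4). [cite: Bloch1972Semiregularity, §1 (reading: intrinsic to the pair Z ⊂ X)] -/
theorem isBlochSemiregular_iff_of_iso_pair {X₀ X₁ : Over (Spec (CommRingCat.of S))} (ε : X₀ ≅ X₁) {Z₀ Z₁ : Scheme.{u}}
    (e : Z₀ ≅ Z₁) {i₀ : Z₀ ⟶ X₀.left} {i₁ : Z₁ ⟶ X₁.left} (w : i₀ ≫ ε.hom.left = e.hom ≫ i₁) {n p : ℕ} :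
    IsBlochSemiregular i₀ n p ↔ IsBlochSemiregular i₁ n p := by
  rw [← isBlochSemiregular_compIso_iff ε i₀, w, isBlochSemiregular_isoComp_iff]

end Transfer

/-! ## §29.5 The checker consequences: the lci-door verdict is a function of (design json, presentation, section) -/

section Checker

variable {S : Type} [CommRing S] {X : Over (Spec (CommRingCat.of S))} {𝓕 : X.left.Modules}
  {s : unitModule X.left ⟶ 𝓕} {Z Z' : Scheme.{0}} {i : Z ⟶ X.left} {i' : Z' ⟶ X.left}

/-- **C7 DOES NOT DEPEND ON THE CHOSEN ZERO SCHEME** (the conjunct v16 §19.5 could not transfer): two zero schemes of the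
same section are isomorphic over `X` (`IsZeroSchemeOf.exists_iso`), and §29.4 applies. [cite: Fulton1998, B.3.2 (PDF p. 410)] -/
theorem isBlochSemiregular_iff_of_isZeroSchemeOf (hZ : IsZeroSchemeOf s i) (hZ' : IsZeroSchemeOf s i') {n p : ℕ} :
    IsBlochSemiregular i n p ↔ IsBlochSemiregular i' n p := by
  obtain ⟨e, he, -⟩ := hZ.exists_iso hZ'
  exact isBlochSemiregular_iff_of_iso_over e he

/-- C7 of ANY zero scheme of `s` is C7 of the canonical one `Z(s(1)) ↪ X` (`𝓕` finite locally free). [cite: Fulton1998, B.3.2 (PDF p. 410)] -/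
theorem isBlochSemiregular_iff_zeroSchemeι (h𝓕 : IsFiniteLocallyFree 𝓕) (hZ : IsZeroSchemeOf s i) {n p : ℕ} :
    IsBlochSemiregular i n p ↔ IsBlochSemiregular (zeroSchemeι 𝓕 (secOf s)) n p :=
  isBlochSemiregular_iff_of_isZeroSchemeOf hZ (isZeroSchemeOf_zeroSchemeι h𝓕 s)

end Checker

section Doors

variable {E₀ : AbelianVariety ℂ} {ψ₀ : E₀ ⟶ E₀} {C : ChernCharacterBetti}

/-- **THE SEED CHECK DOES NOT DEPEND ON THE MODEL OF THE ZERO SCHEME — ALL CONJUNCTS, C7 INCLUDED** (v16's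
`Design.SeedCheck.of_isZeroSchemeOf` with the hypothesis `hsr'` REMOVED): `D.SeedCheck K i q`, `i` and `i'` zero schemes of the
same section ⟹ `D.SeedCheck K i' q`. -/
theorem _root_.Summit.HodgeConjecture.HodgeConjecture.Cruxes.BlochSeedDiscOne.SeedChecker.Design.SeedCheck.of_isZeroSchemeOf'
    {D : Design} {K : AnchorKit E₀ ψ₀} {𝓕 : (pad4Anchor E₀).X.left.Modules}
    {s : unitModule (pad4Anchor E₀).X.left ⟶ 𝓕} {Z Z' : Scheme.{0}} {i : Z ⟶ (pad4Anchor E₀).X.left}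
    {i' : Z' ⟶ (pad4Anchor E₀).X.left} {q : ℚ} (h : D.SeedCheck K i q) (hZ : IsZeroSchemeOf s i)
    (hZ' : IsZeroSchemeOf s i') : D.SeedCheck K i' q :=
  h.of_isZeroSchemeOf hZ hZ' ((isBlochSemiregular_iff_of_isZeroSchemeOf hZ hZ').mp h.2.2.2.2.2.1)

/-- **`D.SeedCheck K i q ↔ D.SeedCheck K i' q`** for any two zero schemes of the same section: the lci-door verdict is
MODEL-INDEPENDENT. -/
theorem _root_.Summit.HodgeConjecture.HodgeConjecture.Cruxes.BlochSeedDiscOne.SeedChecker.Design.seedCheck_iff_of_isZeroSchemeOf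
    {D : Design} {K : AnchorKit E₀ ψ₀} {𝓕 : (pad4Anchor E₀).X.left.Modules}
    {s : unitModule (pad4Anchor E₀).X.left ⟶ 𝓕} {Z Z' : Scheme.{0}} {i : Z ⟶ (pad4Anchor E₀).X.left}
    {i' : Z' ⟶ (pad4Anchor E₀).X.left} {q : ℚ} (hZ : IsZeroSchemeOf s i) (hZ' : IsZeroSchemeOf s i') :
    D.SeedCheck K i q ↔ D.SeedCheck K i' q :=
  ⟨fun h => h.of_isZeroSchemeOf' hZ hZ', fun h => h.of_isZeroSchemeOf' hZ' hZ⟩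

/-- **THE VERDICT IS A FUNCTION OF (design json, presentation, section)**: for `𝓕` finite locally free and ANY zero scheme
`i` of `s`, `D.SeedCheck K i q ↔ D.SeedCheck K (Z(s(1)) ↪ S⁴) q` — the carrier has dropped out of the lci door entirely
(existence v16 §19.2, uniqueness v16 §19.2, transfer of C5 ∕ C6 ∕ (σ) v16 §19.5, transfer of C7 §29.4). [cite: Fulton1998, B.3.2 and B.3.4 (PDF pp. 410–411)] -/
theorem _root_.Summit.HodgeConjecture.HodgeConjecture.Cruxes.BlochSeedDiscOne.SeedChecker.Design.seedCheck_iff_zeroSchemeι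
    {D : Design} {K : AnchorKit E₀ ψ₀} {𝓕 : (pad4Anchor E₀).X.left.Modules}
    {s : unitModule (pad4Anchor E₀).X.left ⟶ 𝓕} {Z : Scheme.{0}} {i : Z ⟶ (pad4Anchor E₀).X.left} {q : ℚ}
    (h𝓕 : IsFiniteLocallyFree 𝓕) (hZ : IsZeroSchemeOf s i) :
    D.SeedCheck K i q ↔ D.SeedCheck K (zeroSchemeι 𝓕 (secOf s)) q :=
  Design.seedCheck_iff_of_isZeroSchemeOf hZ (isZeroSchemeOf_zeroSchemeι h𝓕 s)

/-- **THE LCI DOOR WITH EACH OF C5 ∕ C6 ∕ C7 READ ON A MODEL OF THE PRESENTER'S CHOICE**: `D` passes C0; `𝓕` of rank `4` on the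
anchor is (A1)-clean at the seed with the design's `μ` in a window `⊇ {1, 2, 3}`; `t ∈ Γ(S⁴, 𝓕)`; three (possibly different)
zero schemes `i₅`, `i₆`, `i₇` of the section `a ↦ a·t` pass C5, C6, C7 respectively ⟹ `D.SeedCheck K (Z(t) ↪ S⁴) q` for some
`q`, GIVEN the named law `TopChernFourLocalisation C` exactly as in v4 ∕ v16. Hypothesis-carrying; nothing is asserted.
[cite: Fulton1998, §14.1 and B.3.4] -/
theorem _root_.Summit.HodgeConjecture.HodgeConjecture.Cruxes.BlochSeedDiscOne.SeedChecker.Design.seedCheck_of_section_anyModel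
    (hE : E₀.dim = 1) (hψ : ψ₀ ≫ ψ₀ = -(1 • 𝟙 E₀)) {D : Design} (hC0 : D.ClassData) (K : AnchorKit E₀ ψ₀) {I : Finset ℕ}
    {𝓕 : (pad4Anchor E₀).X.left.Modules} (hloc : TopChernFourLocalisation C) (hrk : HasRank 𝓕 4)
    (hcl : CleanAtSeed C I K.F (hStd E₀ K.η) 𝓕 D.mu) (h1 : 1 ∈ I) (h2 : 2 ∈ I) (h3 : 3 ∈ I) (t : Γ(𝓕, ⊤))
    {Z₅ Z₆ Z₇ : Scheme.{0}} {i₅ : Z₅ ⟶ (pad4Anchor E₀).X.left} {i₆ : Z₆ ⟶ (pad4Anchor E₀).X.left}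
    {i₇ : Z₇ ⟶ (pad4Anchor E₀).X.left} (h₅ : IsZeroSchemeOf (mulSection 𝓕 t) i₅) (h₆ : IsZeroSchemeOf (mulSection 𝓕 t) i₆)
    (h₇ : IsZeroSchemeOf (mulSection 𝓕 t) i₇) (hreg : IsRegularImmersionOfCodim i₅ 4) (hint : AlgebraicGeometry.IsIntegral Z₆)
    (hcoh : ∀ z ∈ Set.range i₆.base, ((4 : ℕ) : ℕ∞) ≤ Order.coheight z) (hsr : IsBlochSemiregular i₇ (2 * 4) 4) :
    ∃ q : ℚ, D.SeedCheck K (zeroSchemeι 𝓕 t) q :=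
  have h0 : IsZeroSchemeOf (mulSection 𝓕 t) (zeroSchemeι 𝓕 t) := isZeroSchemeOf_mulSection (HasRank.isFiniteLocallyFree' hrk) t
  D.seedCheck_of_section hE hψ hC0 K hloc hrk hcl h1 h2 h3 t ((h₅.isRegularImmersionOfCodim_iff h0).mp hreg)
    ((h₆.isIntegral_iff h0).mp hint) ((h₆.forall_coheight_iff h0).mp hcoh) ((isBlochSemiregular_iff_of_isZeroSchemeOf h₇ h0).mp hsr)

end Doors

/-! ## §29.6 Flags and audit

| conjunct of `Design.SeedCheck` | transfers between zero schemes of the same section | by |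
|---|---|---|
| C0 (json) | n∕a (no carrier) | — |
| closed immersion | yes | v16 `IsZeroSchemeOf.isClosedImmersion` (part of the predicate) |
| C5 regular immersion of codim `4` | yes | v16 `IsZeroSchemeOf.isRegularImmersionOfCodim_iff` |
| C6 integral; codim `≥ 4` pointwise | yes | v16 `IsZeroSchemeOf.isIntegral_iff`, `….forall_coheight_iff` |
| **C7 `IsBlochSemiregular i 8 4`** | **yes (NEW, §29.4)** | `isBlochSemiregular_iff_of_isZeroSchemeOf` |
| (σ) support on `range i.base` | yes | v16 `IsZeroSchemeOf.range_eq` |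

Flags (g26 §6 table delta): «C7 model transfer» OPEN → THEOREM (`isBlochSemiregular_isoComp_iff`, all `n p`, any base ring `S`,
any universe); v16's `hsr'` input of `Design.SeedCheck.of_isZeroSchemeOf` is now IMPLIED (`….of_isZeroSchemeOf'`). C7 itself
(semiregularity of SOME zero scheme of the candidate's section) remains a genuine, non-vacuous condition on the object — this
file transfers it, it does not discharge it. Build status of the checker family is unchanged by this file (it imports only the
BUILT modules v4, v16 and Literature). -/

/-- AUDIT: this file decides nothing about `BlochSeedDiscOne` (18881), H2, HC_AV, HC_CM, № 4, 26512 or HC; it constructs no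
design, presentation, bundle, section or seed. -/
theorem audit_nothing_decided : True := trivial

end Summit.HodgeConjecture.HodgeConjecture.Cruxes.BlochSeedDiscOne.SeedChecker.ModelTransfer

end
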